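import Mathlib

/-!
# The depth-`q` congruence order in `R × R` (solo-informed notes, Part II §7.11 (16.1), STRUCTURE AT m = 2)

For a single Eisenstein congruence of depth `p^k` the local Hecke algebra is `{(a, b) ∈ ℤ_p × ℤ_p : a ≡ b mod p^k}`, generated as a module by
`1 = (1,1)` and `X = (0, p^k)` with `X² = p^k X` (so `𝕋_𝔪 ≅ ℤ_p[X]/(X² − p^k X)`, monogenic, tangent space of dimension one).  This file records the
ring-theoretic skeleton over any commutative ring `R` and any `q : R`, for the congruence predicate `q ∣ x.2 − x.1` on `R × R`: it is closed under
`1`, `+`, `*`; it holds at `X = (0, q)`; `X·X = q•X`; and it holds at `x` iff `x = (a, a) + s•X` for some `a, s`.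
-/

namespace Summit.Langlands.Langlands.Theorems

/-- `1 = (1, 1)` satisfies the congruence. -/
theorem soloInformed_congruence_one {R : Type*} [CommRing R] (q : R) :
    q ∣ (1 : R × R).2 - (1 : R × R).1 := ⟨0, by simp⟩

/-- Closure under addition. -/
theorem soloInformed_congruence_add {R : Type*} [CommRing R] (q : R) (x y : R × R)
    (hx : q ∣ x.2 - x.1) (hy : q ∣ y.2 - y.1) : q ∣ (x + y).2 - (x + y).1 := by
  obtain ⟨s, hs⟩ := hx
  obtain ⟨t, ht⟩ := hy
  refine ⟨s + t, ?_⟩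
  simp only [Prod.snd_add, Prod.fst_add]
  linear_combination hs + ht

/-- Closure under multiplication: `(b − a) ≡ 0`, `(d − c) ≡ 0 ⟹ bd − ac = b(d − c) + c(b − a) ≡ 0`. -/
theorem soloInformed_congruence_mul {R : Type*} [CommRing R] (q : R) (x y : R × R)
    (hx : q ∣ x.2 - x.1) (hy : q ∣ y.2 - y.1) : q ∣ (x * y).2 - (x * y).1 := by
  obtain ⟨s, hs⟩ := hx
  obtain ⟨t, ht⟩ := hy
  refine ⟨x.2 * t + s * y.1, ?_⟩
  simp only [Prod.snd_mul, Prod.fst_mul]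
  linear_combination x.2 * ht + y.1 * hs

/-- `X = (0, q)` satisfies the congruence. -/
theorem soloInformed_congruence_X {R : Type*} [CommRing R] (q : R) :
    q ∣ ((0 : R), q).2 - ((0 : R), q).1 := ⟨1, by simp⟩

/-- The relation `X·X = q•X`: the module spanned by `1` and `X` is closed under products. -/
theorem soloInformed_X_mul_X {R : Type*} [CommRing R] (q : R) :
    (((0 : R), q) * ((0 : R), q) : R × R) = q • ((0 : R), q) := by
  ext <;> simp

/-- Every element satisfying the congruence is `(a, a) + s•X`. -/
theorem soloInformed_congruence_eq_span {R : Type*} [CommRing R] (q : R) (x : R × R) (hx : q ∣ x.2 - x.1) :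
    ∃ a s : R, x = (a, a) + s • ((0 : R), q) := by
  obtain ⟨s, hs⟩ := hx
  refine ⟨x.1, s, Prod.ext ?_ ?_⟩
  · simp
  · simp
    linear_combination hs

/-- Conversely every `(a, a) + s•X` satisfies the congruence. -/
theorem soloInformed_congruence_of_span {R : Type*} [CommRing R] (q a s : R) :
    q ∣ ((a, a) + s • ((0 : R), q)).2 - ((a, a) + s • ((0 : R), q)).1 :=
  ⟨s, by simp [mul_comm]⟩

end Summit.Langlands.Langlands.Theorems
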